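/-
Copyright (c) 2026 the pub-hodgecm-mathlib formalisation cell (harness21).  Prover seat hodgecm-mathlib-K2E4-p07 (g0),
Track B «K2-LIT» ∕ h413, unit «FinGermConstants» of the line `K2_E4_SingularTransferKappaSign`, socket #7R
`K2E4SingularTransferKappaSign.FinGermConstants.sig_K2E3GermConstantRegularHR` (ED. 3): THE LOCAL-TO-GLOBAL REDUCTION — a smooth transfer pair charging a
point `z ∈ H_v` exists as soon as ONE smooth pair satisfies (4.3.1) on a clopen, stably saturated neighbourhood of `z` and charges `z` there.  2026-09-03.
-/
import Literature.NumberTheory.Rogawski1990.LocalStableOrbitalIntegralGlue   -- ★ `stableOrbitalIntegralRel_congr_fun_of_eqOn`; ★ `IsLocSmooth.indicator` ∕ `.add` (via `LocalTransferGlue`)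
import Literature.NumberTheory.Rogawski1990.LocalTransferExistence            -- ★ `IsLocalDeltaTransferExists`, `IsLocalDeltaTransfer`, `IsLocalStablyConjH`, `IsLocalGRegular`
import HarnessLib

/-!
# K2_E4 road (h413 = stmt-HodgeConjecture-24833), unit «FinGermConstants», socket #7R `sig_K2E3GermConstantRegularHR` — the LOCAL-TO-GLOBAL REDUCTION
# at one finite place: «(4.3.1) near `z` with a value at `z`» + «a transfer of the same `φ` exists» ⇒ «a smooth transfer pair charges `z`»

Cell `pub/hodgecm-mathlib` (D-0151), Track B (21-frontier RULING «PUSH BOTH» 2026-09-03), socket module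
`Summits/HodgeConjecture/HodgeConjecture/Cruxes/H413/Lines/K2_E4_SingularTransferKappaSignSigsFinGermConstants.lean` ED. 3 (0b7360e1bac8109c), socket
**`sig_K2E3GermConstantRegularHR`** (R-twin of #7, chair RULING R11 2026-09-03T21:19:25Z; OWNER K2E3, host K2E4-plan, base K2E4-p07): for the PINNED factor `Δ‴` and
EVERY finite place `v`, some smooth `Δ‴_v`-transfer pair `(f^H, f)` has `f^H(γ_{H,v}) ≠ 0`.  ★ `K2E3GermConstantRegularHUnitPair` (p854864) pays it at every
`v ∉ S_bad` where `γ_{H,v}` is integral (a.e. `v`; every non-split `v ∉ S_bad`).  What is left (`v ∈ S_bad`; split `v` with `e₁` non-integral) needs an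
EXPLICIT local transfer near `γ_{H,v}` WITH ITS VALUE (K2E4-p07 census (α)(β), K2/STATUS.md 2026-09-03T21:23:34Z; dealer 21:26:21Z «that is the real L∕XL»).
THIS FILE is the reduction that makes that residue a purely LOCAL statement on the `H`-side: the explicit local transfer is only ever needed on ONE clopen,
stably saturated neighbourhood `W` of the point — the rest of `H_v` is served by ANY transfer of the same `φ` (which `hCTM` supplies: ★ `IsLocalTransferDatum`'s
fourth conjunct ★ `IsLocalDeltaTransferExists`).

THE MATHEMATICS ([LanglandsShelstad1990Descent, §2.2 Lemma 2.2.A p. 11]: «multiplying a given function by the characteristic function of a stably invariant open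
set»; [Rogawski1990, §4.3 (4.3.1) p. 43]).  Let `W ⊆ H_v` be STABLY SATURATED (`a ∼_st b`, `a ∈ W` ⇒ `b ∈ W`; hence a union of whole stable classes, in particular
conjugation invariant) and clopen.  If `(φ^H, φ)` satisfies (4.3.1) at the `G`-regular `γ_H ∈ W` and `(g, φ)` satisfies it at the `G`-regular `γ_H ∉ W`, then
`f^H := 1_W·φ^H + 1_{Wᶜ}·g` satisfies it everywhere: the stable orbital integral `Φ^st_H(γ_H, ·)` reads its argument only on the union of the orbits of the stable
class of `γ_H` (★ `stableOrbitalIntegralRel_congr_fun_of_eqOn`, no measure hypothesis), which lies inside `W` or inside `Wᶜ`.  `f^H` is smooth with `φ^H`, `g`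
(★ `IsLocSmooth.indicator`, ★ `IsLocSmooth.add`) and `f^H(z) = φ^H(z)` for `z ∈ W`.  Nothing here depends on the factor `Δ_v` or on the measure families: the statements
are over an arbitrary ★ `LocalTransferFactor` and arbitrary ★ `OrbitalMeasureFamily`s, so they serve #7 (weak frame) and #7R (pinned frame) alike.

* §1 `conj_mem_of_stablySaturated`, `conj_notMem_of_stablySaturated` — orbits of the stable class of `a` stay on `a`'s side of a stably saturated `W`.
* §2 **`isLocalDeltaTransfer_indicator_add_indicator_compl`** — the patched `1_W·φ^H + 1_{Wᶜ}·ψ^H` is a `Δ_v`-transfer of `f` if `φ^H` is one on `W` and `ψ^H` one off `W`.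
* §3 **`exists_transferPair_apply_ne_zero_of_local`** — ★ `IsLocalDeltaTransferExists` + a clopen stably saturated `W ∋ z` + a smooth pair `(φ^H, φ)` with (4.3.1) on `W`
  and `φ^H(z) ≠ 0` ⇒ `∃ (f^H, f)` smooth, `IsLocalDeltaTransfer … f^H f`, `f^H(z) ≠ 0` — the conclusion of #7 ∕ #7R at the place `v`, token for token.

HONEST LABEL: HC_CM is proved only modulo the 7 printed citations (2 remaining named inputs: hLiu418 = stmt-HodgeConjecture-24832, h413 =
stmt-HodgeConjecture-24833) until rung 0 closes; this file is a `--supports stmt-HodgeConjecture-24833` helper and retires nothing by itself (it reduces #7R at a bad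
place to the LOCAL explicit transfer with value, which it does not supply).
-/

set_option autoImplicit false
set_option linter.dupNamespace false

noncomputable section

open MeasureTheory NumberField IsDedekindDomain
open Literature.NumberTheory.Rogawski1990 Literature.NumberTheory.Automorphic
open scoped Matrix MatrixGroups

namespace Summit.HodgeConjecture.HodgeConjecture.Cruxes.H413.K2E3GermConstantRegularHRLocalReduction

variable (L : Type) [Field L] [NumberField L] [IsCMField L] (H' : Matrix (Fin 3) (Fin 3) L)
  (v : HeightOneSpectrum (𝓞 ↥(maximalRealSubfield L)))

/-! ## §1  Stably saturated subsets of `H_v` -/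

/-- **Orbits of the stable class stay inside a stably saturated set**: if `W` is stably saturated (`a ∼_st b`, `a ∈ W` ⇒ `b ∈ W`), `a ∈ W` and `b ∼_st a`,
then every conjugate `y b y⁻¹` lies in `W` (a conjugate of `b` is stably conjugate to `b`, ★ `isStablyConjH_of_isConj`, hence to `a`, ★ `IsStablyConjH.trans`).
[cite: LanglandsShelstad1990Descent, §2.2 p. 11] [cite: Rogawski1990, §3.1 p. 19] -/
theorem conj_mem_of_stablySaturated {W : Set ((UnitaryGroup.cmDatum L 2 (Matrix.of fun i j : Fin 2 => if i.val + j.val + 1 = 2 then (1 : L) else 0)).Local v × (UnitaryGroup.cmDatum L 1 (Matrix.of fun i j : Fin 1 => if i.val + j.val + 1 = 1 then (1 : L) else 0)).Local v)}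
    (hW : ∀ a b : ((UnitaryGroup.cmDatum L 2 (Matrix.of fun i j : Fin 2 => if i.val + j.val + 1 = 2 then (1 : L) else 0)).Local v × (UnitaryGroup.cmDatum L 1 (Matrix.of fun i j : Fin 1 => if i.val + j.val + 1 = 1 then (1 : L) else 0)).Local v), IsLocalStablyConjH L v a b → a ∈ W → b ∈ W)
    {a : ((UnitaryGroup.cmDatum L 2 (Matrix.of fun i j : Fin 2 => if i.val + j.val + 1 = 2 then (1 : L) else 0)).Local v × (UnitaryGroup.cmDatum L 1 (Matrix.of fun i j : Fin 1 => if i.val + j.val + 1 = 1 then (1 : L) else 0)).Local v)} (ha : a ∈ W) (b : ((UnitaryGroup.cmDatum L 2 (Matrix.of fun i j : Fin 2 => if i.val + j.val + 1 = 2 then (1 : L) else 0)).Local v × (UnitaryGroup.cmDatum L 1 (Matrix.of fun i j : Fin 1 => if i.val + j.val + 1 = 1 then (1 : L) else 0)).Local v)) (hab : IsLocalStablyConjH L v a b) (y : ((UnitaryGroup.cmDatum L 2 (Matrix.of fun i j : Fin 2 => if i.val + j.val + 1 = 2 then (1 : L) else 0)).Local v × (UnitaryGroup.cmDatum L 1 (Matrix.of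 fun i j : Fin 1 => if i.val + j.val + 1 = 1 then (1 : L) else 0)).Local v)) :
    y * b * y⁻¹ ∈ W :=
  hW a _ (hab.trans (isStablyConjH_of_isConj (isConj_iff.2 ⟨y, rfl⟩))) ha

/-- **… and orbits of the stable class of a point OUTSIDE stay outside** (stable conjugacy is symmetric, ★ `IsStablyConjH.symm`).
[cite: LanglandsShelstad1990Descent, §2.2 p. 11] [cite: Rogawski1990, §3.1 p. 19] -/
theorem conj_notMem_of_stablySaturated {W : Set ((UnitaryGroup.cmDatum L 2 (Matrix.of fun i j : Fin 2 => if i.val + j.val + 1 = 2 then (1 : L) else 0)).Local v × (UnitaryGroup.cmDatum L 1 (Matrix.of fun i j : Fin 1 => if i.val + j.val + 1 = 1 then (1 : L) else 0)).Local v)}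
    (hW : ∀ a b : ((UnitaryGroup.cmDatum L 2 (Matrix.of fun i j : Fin 2 => if i.val + j.val + 1 = 2 then (1 : L) else 0)).Local v × (UnitaryGroup.cmDatum L 1 (Matrix.of fun i j : Fin 1 => if i.val + j.val + 1 = 1 then (1 : L) else 0)).Local v), IsLocalStablyConjH L v a b → a ∈ W → b ∈ W)
    {a : ((UnitaryGroup.cmDatum L 2 (Matrix.of fun i j : Fin 2 => if i.val + j.val + 1 = 2 then (1 : L) else 0)).Local v × (UnitaryGroup.cmDatum L 1 (Matrix.of fun i j : Fin 1 => if i.val + j.val + 1 = 1 then (1 : L) else 0)).Local v)} (ha : a ∉ W) (b : ((UnitaryGroup.cmDatum L 2 (Matrix.of fun i j : Fin 2 => if i.val + j.val + 1 = 2 then (1 : L) else 0)).Local v × (UnitaryGroup.cmDatum L 1 (Matrix.of fun i j : Fin 1 => if i.val + j.val + 1 = 1 then (1 : L) else 0)).Local v)) (hab : IsLocalStablyConjH L v a b) (y : ((UnitaryGroup.cmDatum L 2 (Matrix.of fun i j : Fin 2 => if i.val + j.val + 1 = 2 then (1 : L) else 0)).Local v × (UnitaryGroup.cmDatum L 1 (Matrix.of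 fun i j : Fin 1 => if i.val + j.val + 1 = 1 then (1 : L) else 0)).Local v)) :
    y * b * y⁻¹ ∉ W :=
  fun h => ha (hW _ a ((hab.trans (isStablyConjH_of_isConj (isConj_iff.2 ⟨y, rfl⟩))).symm) h)

/-! ## §2  Patching two transfers along a stably saturated set -/

section Patch

variable {L H' v}
variable [∀ a : ((UnitaryGroup.cmDatum L 2 (Matrix.of fun i j : Fin 2 => if i.val + j.val + 1 = 2 then (1 : L) else 0)).Local v × (UnitaryGroup.cmDatum L 1 (Matrix.of fun i j : Fin 1 => if i.val + j.val + 1 = 1 then (1 : L) else 0)).Local v), MeasurableSpace (((UnitaryGroup.cmDatum L 2 (Matrix.of fun i j : Fin 2 => if i.val + j.val + 1 = 2 then (1 : L) else 0)).Local v × (UnitaryGroup.cmDatum L 1 (Matrix.of fun i j : Fin 1 => if i.val + j.val + 1 = 1 then (1 : L) else 0)).Local v) ⧸ Subgroup.centralizer ({a} : Set ((UnitaryGroup.cmDatum L 2 (Matrix.of fun i j : Fin 2 => if i.val + j.val + 1 = 2 then (1 : L) else 0)).Local v × (UnitaryGroup.cmDatum L 1 (Matrix.of fun i j : Fin 1 =>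 if i.val + j.val + 1 = 1 then (1 : L) else 0)).Local v)))]
  [∀ γ : ((UnitaryGroup.cmDatum L 3 H').Local v), MeasurableSpace (((UnitaryGroup.cmDatum L 3 H').Local v) ⧸ Subgroup.centralizer ({γ} : Set ((UnitaryGroup.cmDatum L 3 H').Local v)))]

/-- **The patched function `1_W · φ^H + 1_{Wᶜ} · ψ^H` is a `Δ_v`-transfer of `f`** as soon as `φ^H` satisfies (4.3.1) against `f` at the `G`-regular `γ_H ∈ W`
and `ψ^H` satisfies it at the `G`-regular `γ_H ∉ W`, for `W` stably saturated: `Φ^st_H(γ_H, ·)` reads its argument on the orbits of the stable class of `γ_H` only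
(★ `stableOrbitalIntegralRel_congr_fun_of_eqOn`), all inside `W` (§1) or all inside `Wᶜ`.  Any ★ `LocalTransferFactor`, any measure families.
[cite: Rogawski1990, §4.3 (4.3.1) p. 43; §4.1 (4.1.1) p. 39] [cite: LanglandsShelstad1990Descent, §2.2 Lemma 2.2.A p. 11] -/
theorem isLocalDeltaTransfer_indicator_add_indicator_compl {T : LocalTransferFactor L H' v}
    {mH : OrbitalMeasureFamily ((UnitaryGroup.cmDatum L 2 (Matrix.of fun i j : Fin 2 => if i.val + j.val + 1 = 2 then (1 : L) else 0)).Local v × (UnitaryGroup.cmDatum L 1 (Matrix.of fun i j : Fin 1 => if i.val + j.val + 1 = 1 then (1 : L) else 0)).Local v)} {mG : OrbitalMeasureFamily ((UnitaryGroup.cmDatum L 3 H').Local v)} {W : Set ((UnitaryGroup.cmDatum L 2 (Matrix.of fun i j : Fin 2 => if i.val + j.val + 1 = 2 then (1 : L) else 0)).Local v × (UnitaryGroup.cmDatum L 1 (Matrix.of fun i j : Fin 1 => if i.val + j.val + 1 = 1 then (1 : L) else 0)).Local v)}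
    (hW : ∀ a b : ((UnitaryGroup.cmDatum L 2 (Matrix.of fun i j : Fin 2 => if i.val + j.val + 1 = 2 then (1 : L) else 0)).Local v × (UnitaryGroup.cmDatum L 1 (Matrix.of fun i j : Fin 1 => if i.val + j.val + 1 = 1 then (1 : L) else 0)).Local v), IsLocalStablyConjH L v a b → a ∈ W → b ∈ W)
    {φH ψH : ((UnitaryGroup.cmDatum L 2 (Matrix.of fun i j : Fin 2 => if i.val + j.val + 1 = 2 then (1 : L) else 0)).Local v × (UnitaryGroup.cmDatum L 1 (Matrix.of fun i j : Fin 1 => if i.val + j.val + 1 = 1 then (1 : L) else 0)).Local v) → ℂ} {f : ((UnitaryGroup.cmDatum L 3 H').Local v) → ℂ}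
    (hφ : ∀ γH : ((UnitaryGroup.cmDatum L 2 (Matrix.of fun i j : Fin 2 => if i.val + j.val + 1 = 2 then (1 : L) else 0)).Local v × (UnitaryGroup.cmDatum L 1 (Matrix.of fun i j : Fin 1 => if i.val + j.val + 1 = 1 then (1 : L) else 0)).Local v), γH ∈ W → IsLocalGRegular L v γH →
      stableOrbitalIntegralRel (IsLocalStablyConjH L v) mH φH γH = ∑ᶠ c : ConjClasses ((UnitaryGroup.cmDatum L 3 H').Local v), T.Δ γH (Quotient.out c) * classOrbitalIntegral mG f c)
    (hψ : ∀ γH : ((UnitaryGroup.cmDatum L 2 (Matrix.of fun i j : Fin 2 => if i.val + j.val + 1 = 2 then (1 : L) else 0)).Local v × (UnitaryGroup.cmDatum L 1 (Matrix.of fun i j : Fin 1 => if i.val + j.val + 1 = 1 then (1 : L) else 0)).Local v), γH ∉ W → IsLocalGRegular L v γH →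
      stableOrbitalIntegralRel (IsLocalStablyConjH L v) mH ψH γH = ∑ᶠ c : ConjClasses ((UnitaryGroup.cmDatum L 3 H').Local v), T.Δ γH (Quotient.out c) * classOrbitalIntegral mG f c) :
    IsLocalDeltaTransfer L H' v T mH mG (W.indicator φH + Wᶜ.indicator ψH) f := by
  rw [isLocalDeltaTransfer_iff]
  intro γH hreg
  by_cases hγ : γH ∈ W
  · rw [← hφ γH hγ hreg]
    refine stableOrbitalIntegralRel_congr_fun_of_eqOn mH W (fun b hb y => conj_mem_of_stablySaturated L v hW hγ b hb y) ?_
    intro b hb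
    rw [Pi.add_apply, Set.indicator_of_mem hb, Set.indicator_of_notMem (Set.notMem_compl_iff.2 hb), add_zero]
  · rw [← hψ γH hγ hreg]
    refine stableOrbitalIntegralRel_congr_fun_of_eqOn mH Wᶜ (fun b hb y => conj_notMem_of_stablySaturated L v hW hγ b hb y) ?_
    intro b hb
    rw [Pi.add_apply, Set.indicator_of_notMem (show b ∉ W from hb), Set.indicator_of_mem hb, zero_add]

/-! ## §3  The reduction: a LOCAL pair with a value at `z`, plus the existence of SOME transfer, gives a GLOBAL pair charging `z` -/

/-- **#7 ∕ #7R at one place, reduced to a local statement.**  Let `(Δ_v, m_H, m_G)` admit a smooth transfer of every smooth `φ` (★ `IsLocalDeltaTransferExists`, the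
fourth conjunct of ★ `IsLocalTransferDatum`, which `CanonicalTransferMatrix` hands at every place), let `W ∋ z` be clopen and stably saturated, and let `(φ^H, φ)` be a
smooth pair satisfying (4.3.1) at the `G`-regular points of `W` with `φ^H(z) ≠ 0`.  Then, `g` being any smooth transfer of `φ`, the pair `(1_W·φ^H + 1_{Wᶜ}·g, φ)` is a
smooth `Δ_v`-transfer pair (§2; ★ `IsLocSmooth.indicator`, ★ `IsLocSmooth.add`) with value `φ^H(z) ≠ 0` at `z` — the conclusion of `sig_K2E3GermConstantRegularH[R]` at `v`,
token for token. [cite: Rogawski1990, §4.3 (4.3.1) p. 43; §4.9 Prop. 4.9.1 (a) p. 55; §8.2 Prop. 8.2.1 (a) p. 118] [cite: LanglandsShelstad1990Descent, §2.2 Lemma 2.2.A p. 11] -/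
theorem exists_transferPair_apply_ne_zero_of_local {T : LocalTransferFactor L H' v}
    {mH : OrbitalMeasureFamily ((UnitaryGroup.cmDatum L 2 (Matrix.of fun i j : Fin 2 => if i.val + j.val + 1 = 2 then (1 : L) else 0)).Local v × (UnitaryGroup.cmDatum L 1 (Matrix.of fun i j : Fin 1 => if i.val + j.val + 1 = 1 then (1 : L) else 0)).Local v)} {mG : OrbitalMeasureFamily ((UnitaryGroup.cmDatum L 3 H').Local v)}
    (hex : IsLocalDeltaTransferExists L H' v T mH mG IsLocSmooth IsLocSmooth)
    {W : Set ((UnitaryGroup.cmDatum L 2 (Matrix.of fun i j : Fin 2 => if i.val + j.val + 1 = 2 then (1 : L) else 0)).Local v × (UnitaryGroup.cmDatum L 1 (Matrix.of fun i j : Fin 1 => if i.val + j.val + 1 = 1 then (1 : L) else 0)).Local v)} (hWcl : IsClopen W)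
    (hW : ∀ a b : ((UnitaryGroup.cmDatum L 2 (Matrix.of fun i j : Fin 2 => if i.val + j.val + 1 = 2 then (1 : L) else 0)).Local v × (UnitaryGroup.cmDatum L 1 (Matrix.of fun i j : Fin 1 => if i.val + j.val + 1 = 1 then (1 : L) else 0)).Local v), IsLocalStablyConjH L v a b → a ∈ W → b ∈ W)
    {z : ((UnitaryGroup.cmDatum L 2 (Matrix.of fun i j : Fin 2 => if i.val + j.val + 1 = 2 then (1 : L) else 0)).Local v × (UnitaryGroup.cmDatum L 1 (Matrix.of fun i j : Fin 1 => if i.val + j.val + 1 = 1 then (1 : L) else 0)).Local v)} (hz : z ∈ W)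
    {φH : ((UnitaryGroup.cmDatum L 2 (Matrix.of fun i j : Fin 2 => if i.val + j.val + 1 = 2 then (1 : L) else 0)).Local v × (UnitaryGroup.cmDatum L 1 (Matrix.of fun i j : Fin 1 => if i.val + j.val + 1 = 1 then (1 : L) else 0)).Local v) → ℂ} {φ : ((UnitaryGroup.cmDatum L 3 H').Local v) → ℂ} (hφH : IsLocSmooth φH) (hφs : IsLocSmooth φ)
    (hloc : ∀ γH : ((UnitaryGroup.cmDatum L 2 (Matrix.of fun i j : Fin 2 => if i.val + j.val + 1 = 2 then (1 : L) else 0)).Local v × (UnitaryGroup.cmDatum L 1 (Matrix.of fun i j : Fin 1 => if i.val + j.val + 1 = 1 then (1 : L) else 0)).Local v), γH ∈ W → IsLocalGRegular L v γH →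
      stableOrbitalIntegralRel (IsLocalStablyConjH L v) mH φH γH = ∑ᶠ c : ConjClasses ((UnitaryGroup.cmDatum L 3 H').Local v), T.Δ γH (Quotient.out c) * classOrbitalIntegral mG φ c)
    (hval : φH z ≠ 0) :
    ∃ (fH : ((UnitaryGroup.cmDatum L 2 (Matrix.of fun i j : Fin 2 => if i.val + j.val + 1 = 2 then (1 : L) else 0)).Local v × (UnitaryGroup.cmDatum L 1 (Matrix.of fun i j : Fin 1 => if i.val + j.val + 1 = 1 then (1 : L) else 0)).Local v) → ℂ) (f : ((UnitaryGroup.cmDatum L 3 H').Local v) → ℂ),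
      IsLocSmooth f ∧ IsLocSmooth fH ∧ IsLocalDeltaTransfer L H' v T mH mG fH f ∧ fH z ≠ 0 := by
  obtain ⟨g, hg, hgT⟩ := (isLocalDeltaTransferExists_iff L H' v T mH mG IsLocSmooth IsLocSmooth).1 hex φ hφs
  refine ⟨W.indicator φH + Wᶜ.indicator g, φ, hφs, (hφH.indicator hWcl).add (hg.indicator hWcl.compl), ?_, ?_⟩
  · exact isLocalDeltaTransfer_indicator_add_indicator_compl hW hloc
      (fun γH _ hreg => (isLocalDeltaTransfer_iff L H' v T mH mG g φ).1 hgT γH hreg)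
  · rw [Pi.add_apply, Set.indicator_of_mem hz, Set.indicator_of_notMem (Set.notMem_compl_iff.2 hz), add_zero]
    exact hval

end Patch

end Summit.HodgeConjecture.HodgeConjecture.Cruxes.H413.K2E3GermConstantRegularHRLocalReduction

end
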